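import Literature.MathematicalPhysics.QuantumFieldTheory.Balaban1983to89.B8Ineq159TopCubeTowerSourcePoint

/-!
# `Balaban1983to89.B8SockB9P3SrcAtTopCubeTower` — [Balaban1985RegularSpaces] (1.146) p. 101, (1.57)–(1.59) p. 86, (1.31) p. 82, (1.131) p. 99: THE SOURCED
# b9-SOCKET OF PROPOSITION 3's FRAME (the P₂D slot's inline binder `SB9srcHP`: Landau condition (1.146) with a source `f ∈ R(U₀)`, slack `γ″B₀(α₀+α₁)`)
# HOLDS AT PRINT'S TOP-CUBE TOWER `(T, □₁, …, □_k)` WITH THE PRINTED CLASS `towerBondsP`, PER MEMBER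

statement-level skeleton of published theorems with citation tags; proofs where landed; nothing here is a claim about the
Yang–Mills mass gap

`[Balaban1985RegularSpaces]` ("B8", CMP **99** (1985) 75–102) (1.146) p. 101 («R(U₀)D^{η*}_{U₀}A = f, where f is a function from the space R(U₀)»), (1.57)–(1.59) p. 86,
(1.36)–(1.38) p. 82, (1.7) p. 77, (1.31) p. 82, (1.131) p. 99; [4] = `[Balaban1985BackgroundPropagators]` Thm 3.3 p. 399, (3.40)–(3.47) pp. 397–398; [B9] =
`[Balaban1989LargeFieldRenormalization2]` (3.40) (the Hölder line).

CITATION HEADER (lean-in-tree rule).  Cell `pub-ymgap` (YM Track A, HUMAN RULING D-0062 ∕ D-0149), node N05 = [B8], width seat `pub-ymgap-dag-n05-w3` (g4), CLAIM-2 file (E2).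
WHY.  The P₂D slot's supplier (dag-n05-d p619291 `…N05SubBP2DSlotExistsLawLanGammaPrime`) displays FIVE (1.5)-keyed [4]-type binders; `B8SockB9P3H2AtTopCubeTower(Member)`
inhabit the sourceless `SB9P` per member at the top-cube tower.  THIS FILE does the same for the SOURCED binder `SB9srcHP` — Thm 8's input: the Landau condition is
(1.146) with a source `f` of size `|f|₍₋₂₎, |∇f|₍₋₃₎ < γ₈(α₀+α₁)`, and every line carries the slack `γ″B₀(α₀+α₁)` (line 5: `γβ(α₀+α₁)`).

THE MATHEMATICS (kernel-checked).  ★★ `srcLines_topCube` (the core: the five lines with the Hölder line over ANY pair class `memH ⊆ AdmPair`, so the slot's two-point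
class and [4] (3.40)'s one-point class both follow by `exact`); ★★★ `exists_sockB9P3src_topCube` (the slot's text, by `exact`): for `d ≥ 2`, `2 ≤ L ≤ ρ`, `k ≥ 1`, `β ≥ 0`, `len z ≥ 1` (`z ≠ 0`), a finite-dimensional C⋆-algebra `𝔹`
and every `γ₈ > 0`: `∃ B₀ B₀β cP3 γ″ γβ > 0, ∀ a (η > 0) Λs` (print's shape), the TEXT of `SB9srcHP` at `Ω := (T, □₁(a), …, □_k(a))`, `Λb := towerBondsP …`.  PROOF ROAD:
at level `0` (`Ω₀ = T`) the (1.41) clause gives `W = e^{iηA′}`, `|A′| ≤ α₂η⁻¹ ≤ ½η⁻¹`, so `(1/iη)log W = A′` and (1.146) unfolds to `Δ_{U₀}(D^{η*}_{U₀}A′ − f) = Q^{T*}μ`;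
the source bound at level `0` reads `η²|f| ≤ γ₈(α₀+α₁)`; `B8Ineq159TopCubeTowerSourcePoint.exists_pointBound_src_topCube` gives `η|A′| ≤ P₀N + P₁γ₈(α₀+α₁)` everywhere
(`N := |J(A′)|₍₋₃₎ + |B₁(A′)|`, finite by `bdd_Jcur_of_bound` ∕ `exists_bound_linCovIter_towerBondsP`) and `(Lʲη)|A′| ≤ …` on the sides touching `□_j`; the five lines
follow as in `B8SockB9P3H2AtTopCubeTower` (two-point stencil, `Jcur_def`, `norm_covLap_le`, `weight_mul_hquot_le`) with `B₀ = 4(d+1)L^{3k}P₀`, `γ″ = P₁γ₈/P₀`.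

HONEST SCOPE ∕ A6 — READ THIS.  PER MEMBER SHAPE: `B₀, B₀β, cP3, γ″, γβ` depend on `(L, M, ρ, k)`, `β`, `d`, `𝔹`, `γ₈` through (U)'s non-explicit `α₀(□), B″(□)` — NOT on `a`,
`η`; NOT [4] Thm 3.3 with source (member-uniform `B₀(d, L)` = N06); no knit hypothesis inhabited as typed; no letter of [4] assumed or proved.  IDLE hypotheses of the
text in this proof (LOCATED for the owner, not defects): `f ∈ R(U₀)` (`InR138`), self-adjointness of `f` and `A′`, «`f = 0 ∕ A′ = 0` off `Ω₀ = T`», `|∇f|₍₋₃₎`,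
`InAk … (W·U₀)`, unitarity of `W`.  Non-vacuity: `U₀ = W = 1`, `f = 0`, `A′ = 0`.  Count-neutral; N05 NOT discharged; no count claim; one finite `𝕋⁴` programme at
fixed `ε`, Bałaban as printed; the YM mass gap (Clay) is NOT proved by any of this — R4 closes the conditional finite-`𝕋⁴` rung `BalabanLadder.UV` only; nothing
continuum ∕ ℝ⁴ ∕ OS.  No `sorry`, no `def`, no `instance`, no `notation`.  Unit `pub-ymgap-dag-n05-w3` (g4), 2026-08-28.
-/

noncomputable section

namespace Literature.MathematicalPhysics.QuantumFieldTheory.Balaban1983to89.B8SockB9P3SrcAtTopCubeTower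

open B7Prop1Explicit B7Prop2Explicit B7Prop1Local B7Eq78Linearization
open B7Prop4GeneralLevels (linCovIter)
open B8Ineq132 (covDerivFwd BondTouches InAk)
open B8Eq140Level (SideTouches sideTouches_of_bondTouches)
open B8Eq146AExpansion (iEta plaqCovDeriv norm_I_eta_smul)
open B8Eq143PlaqExpansion (pdiv)
open B8Eq155JBound (Jcur wsup le_wsup wsup_nonneg)
open B8ScaledSupNorm (bondNorm msup weight Bdd msup_le msup_nonneg weight_mul_norm_le_msup weight_neg_natCast)
open B8Eq138LandauZd (IsLandau146 IsLandau146W InR138 QT covLap covDivB logCfg)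
open B8Eq184Proof (cfgExp)
open B8Lemma1NonAbelian (mulCfg)
open B9Eq340HolderZd (hquot AdmPair)
open B8Eq131CubesAdmissible (cubeFam cubeFam_true_zero cubeFam_of_pos)
open B8Eq131Cubes (cube)
open B8CubeMemberZd (cubeLamS)
open B8TowerBondsPrinted (towerBondsP)
open B9SupplySockB9P3ZdSocketBoundaryMode (logCfg_cfgExp_of_small exists_ne_fin)
open B8Ineq159TopCubeTowerReads (bdd_Jcur_of_bound exists_bound_linCovIter_towerBondsP)
open B8Ineq159TopCubeTowerSourcePoint (exists_pointBound_src_topCube)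
open B8SockB9P3H2AtTopCubeTower (weight_mul_hquot_le)
open B8Prop7GlevZd3 (inAk_mono_alpha)

-- `Site` alone would resolve to the torus sites of `Setup.lean`; re-export the `ℤ^d` sites of `B7Prop1Explicit`.
export B7Prop1Explicit (Site)

variable {d : ℕ} {𝔹 : Type*} [CStarAlgebra 𝔹] [Nontrivial 𝔹]

/-- ★★ **THE CORE: the five sourced lines at print's top-cube tower, the Hölder line over ANY pair class inside the admissible pairs** (`memH j ⊆ AdmPair η len`;
the slot's two-point class and [4] (3.40)'s one-point class are instances).  Binders = the slot's `SB9srcHP` text at `Ω := (T, □₁(a), …, □_k(a))`, `Λb := towerBondsP`,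
but for line 5's membership. [cite: Balaban1985RegularSpaces, (1.146) p.101, (1.57)–(1.59) p.86, (1.38) p.82, (1.31) p.82, (1.131) p.99, (1.7) p.77; Balaban1985BackgroundPropagators, Thm 3.3 p.399, (3.40) p.397, (3.47) p.398] -/
theorem srcLines_topCube [FiniteDimensional ℂ 𝔹] (hd2 : 2 ≤ d) {L : ℕ} (hL2 : 2 ≤ L) (M : ℕ) {ρ : ℕ} (hρ : L ≤ ρ)
    {k : ℕ} (hk : 1 ≤ k) {β : ℝ} (hβ : 0 ≤ β) {len : Site d → ℝ} (hlen : ∀ z : Site d, z ≠ 0 → 1 ≤ len z) {γ₈ : ℝ} (hγ₈ : 0 < γ₈) :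
    ∃ B₀ B₀β cP3 γ'' γβ : ℝ, 0 < B₀ ∧ 0 < B₀β ∧ 0 < cP3 ∧ 0 < γ'' ∧ 0 < γβ ∧ ∀ (a : Site d) (η : ℝ), 0 < η →
      ∀ Λs : ℕ → ℕ → Set (Site d), Λs k 0 = (cube L a M ρ k 1)ᶜ → (∀ j, 1 ≤ j → j ≤ k → Λs k j = cubeLamS L a M ρ k k j) →
      ∀ memH : ℕ → (Fin d × Fin d × (Site d × Site d)) → Prop, (∀ j q, memH j q → q.2.2 ∈ AdmPair η len) →
      ∀ α₀ α₁ α₂ : ℝ, 0 < α₀ → α₀ ≤ cP3 → 0 < α₁ → 0 < α₂ → α₂ ≤ cP3 →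
        ∀ (U₀ W : Site d → Fin d → 𝔹ˣ), (∀ x κ, U₀ x κ ∈ unitaryUnits 𝔹) → (∀ x κ, W x κ ∈ unitaryUnits 𝔹) →
        ∀ f : Site d → 𝔹, InR138 L k η (cubeFam true L a M ρ k 0) (Λs k) U₀ f →
        (∀ x, IsSelfAdjoint (f x)) → (∀ x, x ∉ cubeFam true L a M ρ k 0 → f x = 0) →
        Bdd L k η (-(2 : ℝ)) (fun j (x : Site d) => x ∈ cubeFam true L a M ρ k j) f →
        msup L k η (-(2 : ℝ)) (fun j (x : Site d) => x ∈ cubeFam true L a M ρ k j) f < γ₈ * (α₀ + α₁) →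
        msup L k η (-(3 : ℝ)) (fun j (p : Fin d × Site d) => p.2 ∈ cubeFam true L a M ρ k j) (fun p => covDerivFwd η U₀ p.1 f p.2) < γ₈ * (α₀ + α₁) →
        InAk L k η α₀ (cubeFam true L a M ρ k) U₀ → InAk L k η α₀ (cubeFam true L a M ρ k) (mulCfg W U₀) →
        IsLandau146W L k η (cubeFam true L a M ρ k 0) (Λs k) U₀ f W →
        ∀ A' : Site d → Fin d → 𝔹, (∀ y τ, IsSelfAdjoint (A' y τ)) →
        (∀ j, j ≤ k → ∀ (y : Site d) (τ : Fin d), SideTouches (cubeFam true L a M ρ k j) y τ →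
          W y τ = cfgExp η A' y τ ∧ ‖A' y τ‖ ≤ α₂ * ((L : ℝ) ^ j * η)⁻¹) →
        (∀ (y : Site d) (τ : Fin d), (∀ j, j ≤ k → ¬ SideTouches (cubeFam true L a M ρ k j) y τ) → A' y τ = 0) →
        msup L k η (-(1 : ℝ)) (fun j (b : Site d × Fin d) => SideTouches (cubeFam true L a M ρ k j) b.1 b.2) (fun b => A' b.1 b.2)
            ≤ B₀ * (bondNorm L k η (-(3 : ℝ)) (cubeFam true L a M ρ k) (fun x μ => Jcur η U₀ A' μ x)
              + wsup 1 (fun p : {p : ℕ × (Site d × Fin d) // p.1 ≤ k ∧ p.2 ∈ towerBondsP L (cubeFam true L a M ρ k) (Λs k) p.1} =>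
                  linCovIter L U₀ (iEta η A') p.1.1 p.1.2.1 p.1.2.2)) + γ'' * B₀ * (α₀ + α₁) ∧
          msup L k η (-(2 : ℝ)) (fun j (t : Fin d × Fin d × Site d) => SideTouches (cubeFam true L a M ρ k j) t.2.2 t.2.1)
              (fun t => covDerivFwd η U₀ t.1 (fun z => A' z t.2.1) t.2.2)
            ≤ B₀ * (bondNorm L k η (-(3 : ℝ)) (cubeFam true L a M ρ k) (fun x μ => Jcur η U₀ A' μ x)
              + wsup 1 (fun p : {p : ℕ × (Site d × Fin d) // p.1 ≤ k ∧ p.2 ∈ towerBondsP L (cubeFam true L a M ρ k) (Λs k) p.1} =>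
                  linCovIter L U₀ (iEta η A') p.1.1 p.1.2.1 p.1.2.2)) + γ'' * B₀ * (α₀ + α₁) ∧
          bondNorm L k η (-(3 : ℝ)) (cubeFam true L a M ρ k) (fun x μ => pdiv η U₀ (plaqCovDeriv η U₀ A') μ x)
            ≤ B₀ * (bondNorm L k η (-(3 : ℝ)) (cubeFam true L a M ρ k) (fun x μ => Jcur η U₀ A' μ x)
              + wsup 1 (fun p : {p : ℕ × (Site d × Fin d) // p.1 ≤ k ∧ p.2 ∈ towerBondsP L (cubeFam true L a M ρ k) (Λs k) p.1} =>
                  linCovIter L U₀ (iEta η A') p.1.1 p.1.2.1 p.1.2.2)) + γ'' * B₀ * (α₀ + α₁) ∧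
          bondNorm L k η (-(3 : ℝ)) (cubeFam true L a M ρ k) (fun x μ => covLap η U₀ (fun z => A' z μ) x)
            ≤ B₀ * (bondNorm L k η (-(3 : ℝ)) (cubeFam true L a M ρ k) (fun x μ => Jcur η U₀ A' μ x)
              + wsup 1 (fun p : {p : ℕ × (Site d × Fin d) // p.1 ≤ k ∧ p.2 ∈ towerBondsP L (cubeFam true L a M ρ k) (Λs k) p.1} =>
                  linCovIter L U₀ (iEta η A') p.1.1 p.1.2.1 p.1.2.2)) + γ'' * B₀ * (α₀ + α₁) ∧
          msup L k η (-(2 + β)) memH (fun q => hquot η β len U₀ (covDerivFwd η U₀ q.1 (fun z => A' z q.2.1)) q.2.2)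
            ≤ B₀β * (bondNorm L k η (-(3 : ℝ)) (cubeFam true L a M ρ k) (fun x μ => Jcur η U₀ A' μ x)
              + wsup 1 (fun p : {p : ℕ × (Site d × Fin d) // p.1 ≤ k ∧ p.2 ∈ towerBondsP L (cubeFam true L a M ρ k) (Λs k) p.1} =>
                  linCovIter L U₀ (iEta η A') p.1.1 p.1.2.1 p.1.2.2)) + γβ * (α₀ + α₁) := by
  classical
  obtain ⟨cP3, P₀, P₁, hcP3pos, hcP3h, h1P, hP₁0, HP⟩ := exists_pointBound_src_topCube (𝔹 := 𝔹) hd2 hL2 M hρ hk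
  have hP₀0 : 0 < P₀ := by linarith
  have hL1 : 1 ≤ L := le_trans (by norm_num) hL2
  have hL1r : (1 : ℝ) ≤ L := by exact_mod_cast hL1
  have hLk1 : (1 : ℝ) ≤ (L : ℝ) ^ k := one_le_pow₀ hL1r
  have hd1 : (1 : ℝ) ≤ d := by exact_mod_cast (le_trans (by norm_num) hd2 : 1 ≤ d)
  -- the constants: `B₀ = K·P₀`, `γ″B₀ = K·P₁γ₈`, `K = 4(d+1)L^{3k}`
  obtain ⟨K, hK⟩ : ∃ c : ℝ, c = 4 * ((d : ℝ) + 1) * ((L : ℝ) ^ k) ^ 3 := ⟨_, rfl⟩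
  have hK0 : 0 < K := by rw [hK]; positivity
  have hK1 : 1 ≤ K := by rw [hK]; exact one_le_mul_of_one_le_of_one_le (by linarith) (one_le_pow₀ hLk1)
  have hK2 : 2 * ((L : ℝ) ^ k) ^ 2 ≤ K := by
    rw [hK]
    exact (mul_le_mul_of_nonneg_left (pow_le_pow_right₀ hLk1 (by norm_num : 2 ≤ 3)) (by norm_num)).trans
      (mul_le_mul_of_nonneg_right (by linarith) (by positivity))
  have hK4 : 4 * (d : ℝ) * ((L : ℝ) ^ k) ^ 3 ≤ K := by rw [hK]; exact mul_le_mul_of_nonneg_right (by linarith) (by positivity)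
  refine ⟨K * P₀, 4 * ((L : ℝ) ^ k) ^ 2 * ((L : ℝ) ^ k) ^ β * P₀, cP3, P₁ * γ₈ / P₀, 4 * ((L : ℝ) ^ k) ^ 2 * ((L : ℝ) ^ k) ^ β * P₁ * γ₈,
    by positivity, by positivity, hcP3pos, by positivity, by positivity, ?_⟩
  intro a η hη Λs hΛ0 hΛ memH hmemH α₀ α₁ α₂ hα₀ hα₀c hα₁ hα₂ hα₂c U₀ W hU₀ _ f _ _ _ hfB hfsup _ hAk _ hLanW A' _ h41 _
  have hU1 : ∀ x κ, U₀ x κ ∈ U1 𝔹 := fun x κ => unitaryUnits_le_U1 (hU₀ x κ)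
  have hηne : η ≠ 0 := hη.ne'
  obtain ⟨s, hs⟩ : ∃ t : ℝ, t = γ₈ * (α₀ + α₁) := ⟨_, rfl⟩
  have hs0 : 0 < s := by rw [hs]; positivity
  -- (0) `Ω₀ = T`: the (1.41) clause at level `0` is global; `W = e^{iηA′}`, `(1/iη) log W = A′`; the source is bounded by `s η⁻²`
  have hST0 : ∀ (y : Site d) (τ : Fin d), SideTouches (cubeFam true L a M ρ k 0) y τ := fun y τ => by
    obtain ⟨κ, hκ⟩ := exists_ne_fin hd2 τ
    rw [cubeFam_true_zero]
    exact sideTouches_of_bondTouches hκ (Or.inl (Set.mem_univ y))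
  have hAb : ∀ (y : Site d) (τ : Fin d), ‖A' y τ‖ ≤ α₂ * η⁻¹ := fun y τ => by
    have h := (h41 0 (Nat.zero_le k) y τ (hST0 y τ)).2
    rwa [pow_zero, one_mul] at h
  have hα₂η : 0 ≤ α₂ * η⁻¹ := by positivity
  have hWexp : W = cfgExp η A' := funext fun y => funext fun τ => (h41 0 (Nat.zero_le k) y τ (hST0 y τ)).1
  have hlog : logCfg η W = A' := by
    rw [hWexp]
    refine logCfg_cfgExp_of_small hη fun y τ => ?_
    have h1 : η * ‖A' y τ‖ ≤ α₂ := by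
      calc η * ‖A' y τ‖ ≤ η * (α₂ * η⁻¹) := mul_le_mul_of_nonneg_left (hAb y τ) hη.le
        _ = α₂ := by field_simp
    linarith [Real.log_two_gt_d9, hα₂c.trans hcP3h]
  have hfpt : ∀ x : Site d, ‖f x‖ ≤ s * (η ^ 2)⁻¹ := fun x => by
    have h := weight_mul_norm_le_msup hfB (Nat.zero_le k) (i := x) (by rw [cubeFam_true_zero]; exact Set.mem_univ x)
    have e2 : weight L η (-(2 : ℝ)) 0 = η ^ 2 := by
      rw [show (-(2 : ℝ)) = -((2 : ℕ) : ℝ) by norm_num, weight_neg_natCast, pow_zero, one_mul]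
    rw [e2] at h
    rw [le_mul_inv_iff₀ (by positivity : (0 : ℝ) < η ^ 2), mul_comm, hs]
    exact h.trans hfsup.le
  have hLan' : ∃ μ : ℕ → Site d → 𝔹, ∀ x, covLap η U₀ (fun z => covDivB η U₀ A' z - f z) x = QT L k (Λs k) U₀ μ x := by
    have h := hLanW
    unfold IsLandau146W IsLandau146 at h
    rw [hlog, cubeFam_true_zero] at h
    obtain ⟨-, μ, hμ⟩ := h
    exact ⟨μ, fun x => by have h1 := hμ x (Set.mem_univ x); rwa [Set.indicator_univ] at h1⟩
  -- (1) the target `N = |J(A′)|₍₋₃₎ + |B₁(A′)|` dominates the current and the class averages (bounded families)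
  obtain ⟨N, hN⟩ : ∃ t : ℝ, t = bondNorm L k η (-(3 : ℝ)) (cubeFam true L a M ρ k) (fun x μ => Jcur η U₀ A' μ x) +
    wsup 1 (fun p : {p : ℕ × (Site d × Fin d) // p.1 ≤ k ∧ p.2 ∈ towerBondsP L (cubeFam true L a M ρ k) (Λs k) p.1} =>
      linCovIter L U₀ (iEta η A') p.1.1 p.1.2.1 p.1.2.2) := ⟨_, rfl⟩
  have hN0 : 0 ≤ N := by rw [hN]; exact add_nonneg (msup_nonneg L k hη.le _ _ _) (wsup_nonneg zero_le_one _)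
  have hBJ := bdd_Jcur_of_bound hL1 hη hU1 k (cubeFam true L a M ρ k) hα₂η hAb
  have hiEta : ∀ (y : Site d) (τ : Fin d), ‖iEta η A' y τ‖ ≤ η * (α₂ * η⁻¹) := fun y τ => B8Eq146AExpansion.norm_iEta_le hη.le hAb y τ
  obtain ⟨Cavg, hCavg⟩ := exists_bound_linCovIter_towerBondsP (U₀ := U₀) L a M ρ k (Λ := Λs k) hΛ hiEta
  have hNJ : ∀ j, j ≤ k → ∀ (x : Site d) (μ : Fin d), BondTouches (cubeFam true L a M ρ k j) x μ →
      ((L : ℝ) ^ j * η) ^ 3 * ‖Jcur η U₀ A' μ x‖ ≤ N := by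
    intro j hj x μ hb
    have h := weight_mul_norm_le_msup hBJ hj (i := (x, μ)) hb
    rw [show (-(3 : ℝ)) = -((3 : ℕ) : ℝ) by norm_num, weight_neg_natCast] at h
    rw [hN]; exact h.trans (le_add_of_nonneg_right (wsup_nonneg zero_le_one _))
  have hNavg : ∀ j, j ≤ k → ∀ c ∈ towerBondsP L (cubeFam true L a M ρ k) (Λs k) j, ‖linCovIter L U₀ (iEta η A') j c.1 c.2‖ ≤ N := by
    intro j hj c hc
    have h := le_wsup hCavg ⟨(j, c), hj, hc⟩
    rw [one_mul] at h
    rw [hN]; exact h.trans (le_add_of_nonneg_left (msup_nonneg L k hη.le _ _ _))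
  -- (2) the pointwise bounds of `B8Ineq159TopCubeTowerSourcePoint`
  obtain ⟨POINT, LEV⟩ := HP a η hη (Λs k) hΛ0 hΛ U₀ hU₀ (inAk_mono_alpha hη hα₀c hAk) A' f s hs0.le hfpt hLan' N hN0 hNJ hNavg
  obtain ⟨Q, hQ⟩ : ∃ t : ℝ, t = P₀ * N + P₁ * s := ⟨_, rfl⟩
  rw [← hQ] at POINT LEV
  have hQ0 : 0 ≤ Q := by rw [hQ]; positivity
  have POINT' : ∀ (y : Site d) (τ : Fin d), ‖A' y τ‖ ≤ Q * η⁻¹ := fun y τ => by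
    rw [le_mul_inv_iff₀ hη, mul_comm]; exact POINT y τ
  -- the right-hand sides: `c·Q ≤ K·P₀·N + K·P₁·s = B₀·N + γ″B₀(α₀+α₁)` for `c ≤ K`
  have hGid : K * P₀ * N + K * P₁ * s = K * P₀ * N + P₁ * γ₈ / P₀ * (K * P₀) * (α₀ + α₁) := by
    rw [hs]; field_simp
  have hfin : ∀ c : ℝ, 0 ≤ c → c ≤ K → c * Q ≤ K * P₀ * N + P₁ * γ₈ / P₀ * (K * P₀) * (α₀ + α₁) := by
    intro c _ hcK
    rw [← hGid, hQ, mul_add, ← mul_assoc, ← mul_assoc]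
    exact add_le_add (mul_le_mul_of_nonneg_right (mul_le_mul_of_nonneg_right hcK hP₀0.le) hN0)
      (mul_le_mul_of_nonneg_right (mul_le_mul_of_nonneg_right hcK hP₁0.le) hs0.le)
  have hLj : ∀ j, j ≤ k → (L : ℝ) ^ j ≤ (L : ℝ) ^ k := fun j hj => pow_le_pow_right₀ hL1r hj
  rw [← hN]
  refine ⟨?_, ?_, ?_, ?_, ?_⟩
  · -- LINE 1
    refine (msup_le hQ0 fun j hj b hb => ?_).trans ((one_mul Q).symm.trans_le (hfin 1 zero_le_one hK1))
    rw [show (-(1 : ℝ)) = -((1 : ℕ) : ℝ) by norm_num, weight_neg_natCast, pow_one]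
    rcases Nat.eq_zero_or_pos j with rfl | hj1
    · rw [pow_zero, one_mul]; exact POINT b.1 b.2
    · rw [cubeFam_of_pos true L a M ρ hj1 hj] at hb
      exact LEV j hj1 hj b.1 b.2 hb
  · -- LINE 2
    refine (msup_le (by positivity) fun j hj t _ => ?_).trans (hfin _ (by positivity) hK2)
    rw [show (-(2 : ℝ)) = -((2 : ℕ) : ℝ) by norm_num, weight_neg_natCast]
    have hD := B8Ineq159StencilsNearFlat.norm_covDerivFwd_le hU1 hη t.1 (fun z => A' z t.2.1) t.2.2
    calc ((L : ℝ) ^ j * η) ^ 2 * ‖covDerivFwd η U₀ t.1 (fun z => A' z t.2.1) t.2.2‖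
        ≤ ((L : ℝ) ^ k * η) ^ 2 * (η⁻¹ * (‖A' (t.2.2 + e t.1) t.2.1‖ + ‖A' t.2.2 t.2.1‖)) :=
          mul_le_mul (pow_le_pow_left₀ (by positivity) (mul_le_mul_of_nonneg_right (hLj j hj) hη.le) 2) hD (norm_nonneg _) (by positivity)
      _ = ((L : ℝ) ^ k) ^ 2 * (η * ‖A' (t.2.2 + e t.1) t.2.1‖ + η * ‖A' t.2.2 t.2.1‖) := by field_simp
      _ ≤ ((L : ℝ) ^ k) ^ 2 * (Q + Q) := mul_le_mul_of_nonneg_left (add_le_add (POINT _ _) (POINT _ _)) (by positivity)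
      _ = 2 * ((L : ℝ) ^ k) ^ 2 * Q := by ring
  · -- LINE 3 (`J := pdiv ∘ plaqCovDeriv` by definition)
    calc bondNorm L k η (-(3 : ℝ)) (cubeFam true L a M ρ k) (fun x μ => pdiv η U₀ (plaqCovDeriv η U₀ A') μ x)
        = bondNorm L k η (-(3 : ℝ)) (cubeFam true L a M ρ k) (fun x μ => Jcur η U₀ A' μ x) := rfl
      _ ≤ N := by rw [hN]; exact le_add_of_nonneg_right (wsup_nonneg zero_le_one _)
      _ ≤ 1 * Q := by
          rw [one_mul, hQ]
          exact (le_mul_of_one_le_left hN0 h1P).trans (le_add_of_nonneg_right (by positivity))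
      _ ≤ _ := hfin 1 zero_le_one hK1
  · -- LINE 4
    refine (msup_le (by positivity) fun j hj b _ => ?_).trans (hfin _ (by positivity) hK4)
    rw [show (-(3 : ℝ)) = -((3 : ℕ) : ℝ) by norm_num, weight_neg_natCast]
    have hC := B8Ineq159StencilsNearFlat.norm_covLap_le hU1 hη (g := fun z => A' z b.2) (fun z => POINT' z b.2) b.1
    calc ((L : ℝ) ^ j * η) ^ 3 * ‖covLap η U₀ (fun z => A' z b.2) b.1‖
        ≤ ((L : ℝ) ^ k * η) ^ 3 * (4 * d * (η ^ 2)⁻¹ * (Q * η⁻¹)) :=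
          mul_le_mul (pow_le_pow_left₀ (by positivity) (mul_le_mul_of_nonneg_right (hLj j hj) hη.le) 3) hC (norm_nonneg _) (by positivity)
      _ = 4 * d * ((L : ℝ) ^ k) ^ 3 * Q := by field_simp
  · -- LINE 5 (the Hölder quotient of `∇A′` from `η²|∇A′| ≤ 2Q`)
    refine (msup_le (c := 4 * ((L : ℝ) ^ k) ^ 2 * ((L : ℝ) ^ k) ^ β * Q) (by positivity) fun j hj q hq => ?_).trans
      (le_of_eq (by rw [hQ, hs]; ring))
    have hD : ∀ z, η ^ 2 * ‖covDerivFwd η U₀ q.1 (fun w => A' w q.2.1) z‖ ≤ 2 * Q := by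
      intro z
      have h := B8Ineq159StencilsNearFlat.norm_covDerivFwd_le hU1 hη q.1 (fun w => A' w q.2.1) z
      calc η ^ 2 * ‖covDerivFwd η U₀ q.1 (fun w => A' w q.2.1) z‖ ≤ η ^ 2 * (η⁻¹ * (‖A' (z + e q.1) q.2.1‖ + ‖A' z q.2.1‖)) :=
            mul_le_mul_of_nonneg_left h (by positivity)
        _ = η * ‖A' (z + e q.1) q.2.1‖ + η * ‖A' z q.2.1‖ := by field_simp
        _ ≤ Q + Q := add_le_add (POINT _ _) (POINT _ _)
        _ = 2 * Q := by ring
    calc weight L η (-(2 + β)) j * ‖hquot η β len U₀ (covDerivFwd η U₀ q.1 fun w => A' w q.2.1) q.2.2‖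
        ≤ 2 * ((L : ℝ) ^ k) ^ 2 * ((L : ℝ) ^ k) ^ β * (2 * Q) :=
          weight_mul_hquot_le hL1 hη hβ hlen hU1 (by positivity) hD hj (x := q.2.2.1) (x' := q.2.2.2) (hmemH j q hq)
      _ = 4 * ((L : ℝ) ^ k) ^ 2 * ((L : ℝ) ^ k) ^ β * Q := by ring


/-- ★★★ **THE SOURCED b9-SOCKET OF PROPOSITION 3's FRAME HOLDS AT PRINT'S TOP-CUBE TOWER WITH THE PRINTED CLASS, PER MEMBER.**  For `d ≥ 2`, `2 ≤ L ≤ ρ`, `k ≥ 1`,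
`β ≥ 0`, a length function with `len z ≥ 1` for `z ≠ 0`, a finite-dimensional C⋆-algebra `𝔹` and every `γ₈ > 0`: there are `B₀, B₀β, cP3, γ″, γβ > 0` (depending on
`L, M, ρ, k, β, d, 𝔹, γ₈` only) such that for EVERY position `a`, spacing `η > 0` and restriction family `Λs` of print's shape the TEXT of the slot's binder `SB9srcHP`
holds at `Ω := (T, □₁(a), …, □_k(a))`, `Λb := towerBondsP …`: for unitary `U₀ ∈ 𝔄_k(α₀)`, `W = e^{iηA′}` with `|A′| ≤ α₂(Lʲη)⁻¹`, a source `f` with `|f|₍₋₂₎, |∇f|₍₋₃₎ <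
γ₈(α₀+α₁)`, and `W` in the SOURCED Landau gauge (1.146) `R(U₀)D^{η*}_{U₀}A′ = f` — the five lines of (1.59) with right-hand side `B₀(|J|₍₋₃₎ + |B₁|) + γ″B₀(α₀+α₁)`
(line 5: `B₀β(…) + γβ(α₀+α₁)`).  PER MEMBER: NOT [4] Thm 3.3's uniform constants. [cite: Balaban1985RegularSpaces, (1.146) p.101, (1.57)–(1.59) p.86, (1.38) p.82, (1.31) p.82, (1.131) p.99, (1.7) p.77; Balaban1985BackgroundPropagators, Thm 3.3 p.399, (3.43), (3.47) p.398; Balaban1989LargeFieldRenormalization2, (3.40)] -/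
theorem exists_sockB9P3src_topCube [FiniteDimensional ℂ 𝔹] (hd2 : 2 ≤ d) {L : ℕ} (hL2 : 2 ≤ L) (M : ℕ) {ρ : ℕ} (hρ : L ≤ ρ)
    {k : ℕ} (hk : 1 ≤ k) {β : ℝ} (hβ : 0 ≤ β) {len : Site d → ℝ} (hlen : ∀ z : Site d, z ≠ 0 → 1 ≤ len z) {γ₈ : ℝ} (hγ₈ : 0 < γ₈) :
    ∃ B₀ B₀β cP3 γ'' γβ : ℝ, 0 < B₀ ∧ 0 < B₀β ∧ 0 < cP3 ∧ 0 < γ'' ∧ 0 < γβ ∧ ∀ (a : Site d) (η : ℝ), 0 < η →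
      ∀ Λs : ℕ → ℕ → Set (Site d), Λs k 0 = (cube L a M ρ k 1)ᶜ → (∀ j, 1 ≤ j → j ≤ k → Λs k j = cubeLamS L a M ρ k k j) →
      ∀ α₀ α₁ α₂ : ℝ, 0 < α₀ → α₀ ≤ cP3 → 0 < α₁ → 0 < α₂ → α₂ ≤ cP3 →
        ∀ (U₀ W : Site d → Fin d → 𝔹ˣ), (∀ x κ, U₀ x κ ∈ unitaryUnits 𝔹) → (∀ x κ, W x κ ∈ unitaryUnits 𝔹) →
        ∀ f : Site d → 𝔹, InR138 L k η (cubeFam true L a M ρ k 0) (Λs k) U₀ f →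
        (∀ x, IsSelfAdjoint (f x)) → (∀ x, x ∉ cubeFam true L a M ρ k 0 → f x = 0) →
        Bdd L k η (-(2 : ℝ)) (fun j (x : Site d) => x ∈ cubeFam true L a M ρ k j) f →
        msup L k η (-(2 : ℝ)) (fun j (x : Site d) => x ∈ cubeFam true L a M ρ k j) f < γ₈ * (α₀ + α₁) →
        msup L k η (-(3 : ℝ)) (fun j (p : Fin d × Site d) => p.2 ∈ cubeFam true L a M ρ k j) (fun p => covDerivFwd η U₀ p.1 f p.2) < γ₈ * (α₀ + α₁) →
        InAk L k η α₀ (cubeFam true L a M ρ k) U₀ → InAk L k η α₀ (cubeFam true L a M ρ k) (mulCfg W U₀) →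
        IsLandau146W L k η (cubeFam true L a M ρ k 0) (Λs k) U₀ f W →
        ∀ A' : Site d → Fin d → 𝔹, (∀ y τ, IsSelfAdjoint (A' y τ)) →
        (∀ j, j ≤ k → ∀ (y : Site d) (τ : Fin d), SideTouches (cubeFam true L a M ρ k j) y τ →
          W y τ = cfgExp η A' y τ ∧ ‖A' y τ‖ ≤ α₂ * ((L : ℝ) ^ j * η)⁻¹) →
        (∀ (y : Site d) (τ : Fin d), (∀ j, j ≤ k → ¬ SideTouches (cubeFam true L a M ρ k j) y τ) → A' y τ = 0) →
        msup L k η (-(1 : ℝ)) (fun j (b : Site d × Fin d) => SideTouches (cubeFam true L a M ρ k j) b.1 b.2) (fun b => A' b.1 b.2)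
            ≤ B₀ * (bondNorm L k η (-(3 : ℝ)) (cubeFam true L a M ρ k) (fun x μ => Jcur η U₀ A' μ x)
              + wsup 1 (fun p : {p : ℕ × (Site d × Fin d) // p.1 ≤ k ∧ p.2 ∈ towerBondsP L (cubeFam true L a M ρ k) (Λs k) p.1} =>
                  linCovIter L U₀ (iEta η A') p.1.1 p.1.2.1 p.1.2.2)) + γ'' * B₀ * (α₀ + α₁) ∧
          msup L k η (-(2 : ℝ)) (fun j (t : Fin d × Fin d × Site d) => SideTouches (cubeFam true L a M ρ k j) t.2.2 t.2.1)
              (fun t => covDerivFwd η U₀ t.1 (fun z => A' z t.2.1) t.2.2)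
            ≤ B₀ * (bondNorm L k η (-(3 : ℝ)) (cubeFam true L a M ρ k) (fun x μ => Jcur η U₀ A' μ x)
              + wsup 1 (fun p : {p : ℕ × (Site d × Fin d) // p.1 ≤ k ∧ p.2 ∈ towerBondsP L (cubeFam true L a M ρ k) (Λs k) p.1} =>
                  linCovIter L U₀ (iEta η A') p.1.1 p.1.2.1 p.1.2.2)) + γ'' * B₀ * (α₀ + α₁) ∧
          bondNorm L k η (-(3 : ℝ)) (cubeFam true L a M ρ k) (fun x μ => pdiv η U₀ (plaqCovDeriv η U₀ A') μ x)
            ≤ B₀ * (bondNorm L k η (-(3 : ℝ)) (cubeFam true L a M ρ k) (fun x μ => Jcur η U₀ A' μ x)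
              + wsup 1 (fun p : {p : ℕ × (Site d × Fin d) // p.1 ≤ k ∧ p.2 ∈ towerBondsP L (cubeFam true L a M ρ k) (Λs k) p.1} =>
                  linCovIter L U₀ (iEta η A') p.1.1 p.1.2.1 p.1.2.2)) + γ'' * B₀ * (α₀ + α₁) ∧
          bondNorm L k η (-(3 : ℝ)) (cubeFam true L a M ρ k) (fun x μ => covLap η U₀ (fun z => A' z μ) x)
            ≤ B₀ * (bondNorm L k η (-(3 : ℝ)) (cubeFam true L a M ρ k) (fun x μ => Jcur η U₀ A' μ x)
              + wsup 1 (fun p : {p : ℕ × (Site d × Fin d) // p.1 ≤ k ∧ p.2 ∈ towerBondsP L (cubeFam true L a M ρ k) (Λs k) p.1} =>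
                  linCovIter L U₀ (iEta η A') p.1.1 p.1.2.1 p.1.2.2)) + γ'' * B₀ * (α₀ + α₁) ∧
          msup L k η (-(2 + β)) (fun j (q : Fin d × Fin d × (Site d × Site d)) =>
                q.2.2 ∈ AdmPair η len ∧ q.2.2.1 ∈ cubeFam true L a M ρ k j ∧ q.2.2.2 ∈ cubeFam true L a M ρ k j)
              (fun q => hquot η β len U₀ (covDerivFwd η U₀ q.1 (fun z => A' z q.2.1)) q.2.2)
            ≤ B₀β * (bondNorm L k η (-(3 : ℝ)) (cubeFam true L a M ρ k) (fun x μ => Jcur η U₀ A' μ x)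
              + wsup 1 (fun p : {p : ℕ × (Site d × Fin d) // p.1 ≤ k ∧ p.2 ∈ towerBondsP L (cubeFam true L a M ρ k) (Λs k) p.1} =>
                  linCovIter L U₀ (iEta η A') p.1.1 p.1.2.1 p.1.2.2)) + γβ * (α₀ + α₁) := by
  obtain ⟨B₀, B₀β, cP3, γ'', γβ, h1, h2, h3, h4, h5, H⟩ := srcLines_topCube (𝔹 := 𝔹) hd2 hL2 M hρ hk hβ hlen hγ₈
  exact ⟨B₀, B₀β, cP3, γ'', γβ, h1, h2, h3, h4, h5, fun a η hη Λs hΛ0 hΛ =>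
    H a η hη Λs hΛ0 hΛ (fun j q => q.2.2 ∈ AdmPair η len ∧ q.2.2.1 ∈ cubeFam true L a M ρ k j ∧ q.2.2.2 ∈ cubeFam true L a M ρ k j)
      fun _ _ h => h.1⟩

end Literature.MathematicalPhysics.QuantumFieldTheory.Balaban1983to89.B8SockB9P3SrcAtTopCubeTower

end
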